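import Mathlib

/-!
# `DivisionGap.PerMultiplesHard` (stmt-ValiantsHypothesis-5068), line `uncharged-face-walk`, lead c10:
the two-level sumset classification (the arithmetic core of "exponent hiding", crux NOTES §L2(b))

For the crux `PerMultiplesHard` the support of `per_n · H(x^D)` (`H` multilinear, `D ≥ 3`) has all
cell values in the two-level alphabet `L = {0, 1, D, D + 1}` (low bit = permutation cell, high bit =
cofactor cell).  Inside a product gate a cell value is split as `a_e + c_e`; over a whole rectangle
`A + C ⊆ supp` the value sets `V = {a_e}`, `W = {c_e}` at a cell satisfy `V + W ⊆ L`.  The lemma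
below classifies such pairs: one side is constant at the cell, or one side carries exactly the low
bit (`{0,1}`) and the other exactly the high bit (`{0,D}`).  So for `D ≥ 3` every split is rigid cell
by cell, and repeated squaring of a multilinear cofactor hides nothing from the rectangle count
(crux NOTES §L2(b)–(c)).  False for `D = 2` (`{0,1} + {0,1} ⊆ {0,1,2}`: a carry), recorded as
`sumset_twoLevel_sharp_two`.  No definitions (the alphabet is written out as a `Finset` literal).

Helper for item stmt-ValiantsHypothesis-5068 (`--supports`); pure arithmetic, no circuit notions.
-/

-- `Summit.ValiantsHypothesis.ValiantsHypothesis.…` is the tree's mandated layout (Sub = Summit).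
set_option linter.dupNamespace false

namespace Summit.ValiantsHypothesis.ValiantsHypothesis.Theorems.DivisionGap.PerMultiplesHard.TwoLevelSumset

/-- Membership in the two-level alphabet `{0, 1, D, D + 1}` (the cell values of `supp (per · H(x^D))`),
unfolded. [folklore] -/
theorem mem_twoLevel {D x : ℕ} :
    x ∈ ({0, 1, D, D + 1} : Finset ℕ) ↔ x = 0 ∨ x = 1 ∨ x = D ∨ x = D + 1 := by
  simp only [Finset.mem_insert, Finset.mem_singleton]

/-- **Two values on each side pin both sides.** If `v₁ ≠ v₂`, `w₁ ≠ w₂` and all four sums lie in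
`{0, 1, D, D + 1}` with `3 ≤ D`, then `{v₁, v₂} = {0, 1}` and `{w₁, w₂} = {0, D}`, or the reverse.
[folklore] -/
theorem pair_pair {D v₁ v₂ w₁ w₂ : ℕ} (hD : 3 ≤ D) (hv : v₁ ≠ v₂) (hw : w₁ ≠ w₂)
    (h₁₁ : v₁ + w₁ ∈ ({0, 1, D, D + 1} : Finset ℕ)) (h₁₂ : v₁ + w₂ ∈ ({0, 1, D, D + 1} : Finset ℕ))
    (h₂₁ : v₂ + w₁ ∈ ({0, 1, D, D + 1} : Finset ℕ)) (h₂₂ : v₂ + w₂ ∈ ({0, 1, D, D + 1} : Finset ℕ)) :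
    ((v₁ = 0 ∧ v₂ = 1 ∨ v₁ = 1 ∧ v₂ = 0) ∧ (w₁ = 0 ∧ w₂ = D ∨ w₁ = D ∧ w₂ = 0)) ∨
    ((v₁ = 0 ∧ v₂ = D ∨ v₁ = D ∧ v₂ = 0) ∧ (w₁ = 0 ∧ w₂ = 1 ∨ w₁ = 1 ∧ w₂ = 0)) := by
  rw [mem_twoLevel] at h₁₁ h₁₂ h₂₁ h₂₂
  rcases h₁₁ with h₁₁ | h₁₁ | h₁₁ | h₁₁ <;> rcases h₁₂ with h₁₂ | h₁₂ | h₁₂ | h₁₂ <;>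
    rcases h₂₁ with h₂₁ | h₂₁ | h₂₁ | h₂₁ <;> rcases h₂₂ with h₂₂ | h₂₂ | h₂₂ | h₂₂ <;> omega

/-- **One varying side confines the other.** If `w₁ ≠ w₂` both pair with `v₁ ≠ v₂` into the
alphabet and `{w₁, w₂} = {0, D}`, then every `v` pairing with both `w`'s is `0` or `1`. [folklore] -/
theorem val_of_pair_high {D v w₁ w₂ : ℕ} (hw : w₁ = 0 ∧ w₂ = D ∨ w₁ = D ∧ w₂ = 0)
    (h₁ : v + w₁ ∈ ({0, 1, D, D + 1} : Finset ℕ)) (h₂ : v + w₂ ∈ ({0, 1, D, D + 1} : Finset ℕ)) : v = 0 ∨ v = 1 := by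
  rw [mem_twoLevel] at h₁ h₂
  omega

/-- The companion case: if `{w₁, w₂} = {0, 1}` then every `v` pairing with both is `0` or `D`.
[folklore] -/
theorem val_of_pair_low {D v w₁ w₂ : ℕ} (hD : 3 ≤ D) (hw : w₁ = 0 ∧ w₂ = 1 ∨ w₁ = 1 ∧ w₂ = 0)
    (h₁ : v + w₁ ∈ ({0, 1, D, D + 1} : Finset ℕ)) (h₂ : v + w₂ ∈ ({0, 1, D, D + 1} : Finset ℕ)) : v = 0 ∨ v = D := by
  rw [mem_twoLevel] at h₁ h₂
  omega

/-- A finite set of naturals all of whose elements are `x` or `y`, containing two distinct elements,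
is `{x, y}`. [folklore] -/
theorem eq_pair_of_forall {S : Finset ℕ} {x y : ℕ} (hS : ∀ v ∈ S, v = x ∨ v = y)
    {s₁ s₂ : ℕ} (hs₁ : s₁ ∈ S) (hs₂ : s₂ ∈ S) (hne : s₁ ≠ s₂) : S = {x, y} := by
  ext v
  simp only [Finset.mem_insert, Finset.mem_singleton]
  constructor
  · exact hS v
  · rcases hS s₁ hs₁ with h1 | h1 <;> rcases hS s₂ hs₂ with h2 | h2
    · exact absurd (h1.trans h2.symm) hne
    · rintro (rfl | rfl)
      · exact h1 ▸ hs₁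
      · exact h2 ▸ hs₂
    · rintro (rfl | rfl)
      · exact h2 ▸ hs₂
      · exact h1 ▸ hs₁
    · exact absurd (h1.trans h2.symm) hne

/-- **The two-level sumset classification (crux NOTES §L2(b)).** Let `3 ≤ D` and let `V, W` be finite
sets of naturals with `V + W ⊆ {0, 1, D, D + 1}`. Then `V` has at most one element, or `W` has at most
one element, or `(V, W) = ({0,1}, {0,D})`, or `(V, W) = ({0,D}, {0,1})`: over a rectangle of the
support of `per · H(x^D)` a cell is constant on one side, or one side carries exactly the permutation
(low) bit and the other exactly the cofactor (high) bit. [folklore] -/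
theorem sumset_subset_twoLevel : ∀ {D : ℕ}, 3 ≤ D → ∀ (V W : Finset ℕ),
    (∀ v ∈ V, ∀ w ∈ W, v + w ∈ ({0, 1, D, D + 1} : Finset ℕ)) →
      V.card ≤ 1 ∨ W.card ≤ 1 ∨ (V = {0, 1} ∧ W = {0, D}) ∨ (V = {0, D} ∧ W = {0, 1}) := by
  classical
  intro D hD V W h
  by_cases hV : V.card ≤ 1
  · exact Or.inl hV
  by_cases hW : W.card ≤ 1
  · exact Or.inr (Or.inl hW)
  right; right
  obtain ⟨v₁, hv₁, v₂, hv₂, hv⟩ := Finset.one_lt_card.mp (not_le.mp hV)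
  obtain ⟨w₁, hw₁, w₂, hw₂, hw⟩ := Finset.one_lt_card.mp (not_le.mp hW)
  rcases pair_pair hD hv hw (h v₁ hv₁ w₁ hw₁) (h v₁ hv₁ w₂ hw₂) (h v₂ hv₂ w₁ hw₁)
      (h v₂ hv₂ w₂ hw₂) with ⟨hvv, hww⟩ | ⟨hvv, hww⟩
  · -- `V` carries the low bit, `W` the high bit
    left
    refine ⟨eq_pair_of_forall (fun v hv' => val_of_pair_high hww (h v hv' w₁ hw₁) (h v hv' w₂ hw₂))
        hv₁ hv₂ hv, eq_pair_of_forall (fun w hw' => ?_) hw₁ hw₂ hw⟩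
    have h1 := h v₁ hv₁ w hw'
    have h2 := h v₂ hv₂ w hw'
    rw [add_comm v₁ w] at h1
    rw [add_comm v₂ w] at h2
    exact val_of_pair_low hD hvv h1 h2
  · -- `V` carries the high bit, `W` the low bit
    right
    refine ⟨eq_pair_of_forall (fun v hv' => val_of_pair_low hD hww (h v hv' w₁ hw₁) (h v hv' w₂ hw₂))
        hv₁ hv₂ hv, eq_pair_of_forall (fun w hw' => ?_) hw₁ hw₂ hw⟩
    have h1 := h v₁ hv₁ w hw'
    have h2 := h v₂ hv₂ w hw'
    rw [add_comm v₁ w] at h1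
    rw [add_comm v₂ w] at h2
    exact val_of_pair_high hvv h1 h2

/-- **Sharpness at `D = 2`:** the carry `1 + 1 = 2` — `V = W = {0, 1}` has `V + W = {0, 1, 2} ⊆
{0, 1, 2, 3}` with both sides of size two and neither equal to `{0, 2}`; so the classification
needs `D ≥ 3` (for `h = H(x²)` two low bits can make a high bit). [folklore] -/
theorem sumset_twoLevel_sharp_two :
    (∀ v ∈ ({0, 1} : Finset ℕ), ∀ w ∈ ({0, 1} : Finset ℕ), v + w ∈ ({0, 1, 2, 2 + 1} : Finset ℕ)) ∧
      ¬ (({0, 1} : Finset ℕ).card ≤ 1) ∧ ({0, 1} : Finset ℕ) ≠ {0, 2} := by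
  refine ⟨?_, by simp, by decide⟩
  intro v hv w hw
  simp only [Finset.mem_insert, Finset.mem_singleton] at hv hw
  rw [mem_twoLevel]
  omega

end Summit.ValiantsHypothesis.ValiantsHypothesis.Theorems.DivisionGap.PerMultiplesHard.TwoLevelSumset
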